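import Summits.CriticalPhenomena.PercolationContinuityZ3.Theorems.PercNearOneGluingNoHeavyLowerTailSahiOneStepOrLiteral
import HarnessLib

/-!
# One-step scheme: the Ψ-IDENTITY — where the second good-pivot inequality can fail

Support file (prover prim-ineq-prove-3 gen 38; `--supports stmt-CriticalPhenomena-4575`; memo
`run/shared/lean/prim/prim-ineq-prove-3/FINDING-G38-PIVOT-WINDOW.md` §1).  No definitions, no named facts, no sorries.

The good-pivot step `osN_threshold_goodPivot_step` needs, for the sections `B¹ ⊇ B⁰` of the partner at the pivot and the balls
`L¹ = {N_F < t} ⊆ L⁰ = {N_F < t+1}`, the two inequalities `X̃ ≥ 0` and `Ψ ≥ 0`,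
`X̃ = ℓ⁰μ(B¹∩L¹) − ℓ¹μ(B⁰∩L⁰)`, `Ψ = ℓ⁰(1−b⁰)(ℓ¹b¹ − μ(B¹∩L¹)) − ℓ¹(1−b¹)(ℓ⁰b⁰ − μ(B⁰∩L⁰))`.
This file records the exact bookkeeping identity behind `Ψ` (`psi_eq_window`, pure measure algebra for any nested `B⁰ ⊆ B¹`, `L¹ ⊆ L⁰`):

  `Ψ = μ(B⁰ᶜ ∩ L⁰)·κ + ℓ⁰·μ(B¹ᶜ ∩ L¹)·μ((B¹∖B⁰)∖L⁰) − μ(B¹ᶜ∖L⁰)·X̃`,  `κ = σ·μ(B¹ᶜ∩L¹) − ℓ¹·μ(B¹ᶜ∩S)`, `S = L⁰∖L¹`, `σ = μ S`,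

and its consequences for the threshold balls, where `κ ≥ 0` is "a layer carries more of an increasing event than the ball below it"
(`kappa_nonneg`, from `real_inter_ball_mul_layer_le'`): `Ψ` can fail ONLY through the mass of `B¹ᶜ` outside the big ball multiplied by a
POSITIVE `X̃`-margin — (i) `X̃ ≤ 0 ⟹ Ψ ≥ 0` (`psi_nonneg_of_X_nonpos`: at every pivot at least one of the two inequalities holds);
(ii) `B¹ ⊇ (L⁰)ᶜ ⟹ Ψ ≥ 0` (the co-ball lemma `psi_of_coball` of `…CodimThree`, re-derived as `psi_nonneg_of_compl_subset_ball`);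
(iii) the quantitative window `psi_nonneg_of_X_le_window`: `μ(B¹ᶜ∖L⁰)·X̃ ≤ μ(B⁰ᶜ∩L⁰)·κ + ℓ⁰·μ(B¹ᶜ∩L¹)·μ((B¹∖B⁰)∖L⁰) ⟹ Ψ ≥ 0`.
At the codimension-3 slot for a monotone CNF of width `≤ 3`, `μ(B¹ᶜ∖L⁰)` is the mass of "the zero set is exactly a 2-clause avoiding the
pivot" and `μ((B¹∖B⁰)∖L⁰)` the mass of "the zero set is exactly a link of the pivot of size ≤ 2" (memo §0(ii)–(iii)).
-/

namespace Summit.CriticalPhenomena.PercolationContinuityZ3.Theorems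

namespace SahiOneStep

open MeasureTheory Finset
open Literature.Probability.LatticeModels (prodBernoulli)
open scoped Classical

variable {ι : Type*} [Fintype ι]

/-- **Ψ-IDENTITY** (pure measure algebra).  For nested events `B0 ⊆ B1`, `L1 ⊆ L0` under the product measure (any probability measure would do):
`ℓ⁰(1−b⁰)(ℓ¹b¹ − μ(B1∩L1)) − ℓ¹(1−b¹)(ℓ⁰b⁰ − μ(B0∩L0))
   = μ(B0ᶜ∩L0)·[(ℓ⁰−ℓ¹)μ(B1ᶜ∩L1) − ℓ¹μ(B1ᶜ∩(L0∖L1))] + ℓ⁰μ(B1ᶜ∩L1)μ((B1∖B0)∖L0) − μ(B1ᶜ∖L0)·[ℓ⁰μ(B1∩L1) − ℓ¹μ(B0∩L0)]`. [this work] -/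
theorem psi_eq_window (p : ι → unitInterval) {B0 B1 L0 L1 : Set (Set ι)} (hB : B0 ⊆ B1) (hL : L1 ⊆ L0) :
    (prodBernoulli p).real L0 * (1 - (prodBernoulli p).real B0) *
        ((prodBernoulli p).real L1 * (prodBernoulli p).real B1 - (prodBernoulli p).real (B1 ∩ L1))
      - (prodBernoulli p).real L1 * (1 - (prodBernoulli p).real B1) *
        ((prodBernoulli p).real L0 * (prodBernoulli p).real B0 - (prodBernoulli p).real (B0 ∩ L0))
    = (prodBernoulli p).real (B0ᶜ ∩ L0) *
        (((prodBernoulli p).real L0 - (prodBernoulli p).real L1) * (prodBernoulli p).real (B1ᶜ ∩ L1)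
          - (prodBernoulli p).real L1 * (prodBernoulli p).real (B1ᶜ ∩ (L0 \ L1)))
      + (prodBernoulli p).real L0 * (prodBernoulli p).real (B1ᶜ ∩ L1) * (prodBernoulli p).real ((B1 \ B0) \ L0)
      - (prodBernoulli p).real (B1ᶜ \ L0) *
        ((prodBernoulli p).real L0 * (prodBernoulli p).real (B1 ∩ L1)
          - (prodBernoulli p).real L1 * (prodBernoulli p).real (B0 ∩ L0)) := by
  set μ := prodBernoulli p with hμ
  -- the pieces
  set gc : ℝ := μ.real (B1ᶜ \ L0) with hgc
  set gS : ℝ := μ.real (B1ᶜ ∩ (L0 \ L1)) with hgS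
  set g1 : ℝ := μ.real (B1ᶜ ∩ L1) with hg1
  set vc : ℝ := μ.real ((B1 \ B0) \ L0) with hvc
  set vL : ℝ := μ.real ((B1 \ B0) ∩ L0) with hvL
  set l1 : ℝ := μ.real L1 with hl1
  set σ : ℝ := μ.real (L0 \ L1) with hσ
  -- ℓ⁰ = ℓ¹ + σ
  have eL0 : μ.real L0 = l1 + σ := by
    have h := measureReal_inter_add_sdiff (μ := μ) (s := L0) (t := L1) MeasurableSet.of_discrete
    rw [Set.inter_eq_right.2 hL] at h; linarith
  -- μ(B1ᶜ ∩ L0) = g1 + gS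
  have eG0 : μ.real (B1ᶜ ∩ L0) = g1 + gS := by
    have h := measureReal_inter_add_sdiff (μ := μ) (s := B1ᶜ ∩ L0) (t := L1) MeasurableSet.of_discrete
    have e1 : B1ᶜ ∩ L0 ∩ L1 = B1ᶜ ∩ L1 := by
      rw [Set.inter_assoc, Set.inter_eq_right.2 hL]
    have e2 : (B1ᶜ ∩ L0) \ L1 = B1ᶜ ∩ (L0 \ L1) := by
      ext ω; simp only [Set.mem_sdiff, Set.mem_inter_iff, Set.mem_compl_iff]; tauto
    rw [e1, e2] at h; linarith
  -- μ B1ᶜ = (g1 + gS) + gc and μ B1 = 1 − μ B1ᶜ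
  have eG : μ.real B1ᶜ = g1 + gS + gc := by
    have h := measureReal_inter_add_sdiff (μ := μ) (s := B1ᶜ) (t := L0) MeasurableSet.of_discrete
    rw [eG0] at h; linarith
  have eB1 : μ.real B1 = 1 - (g1 + gS + gc) := by
    have h : μ.real B1ᶜ = 1 - μ.real B1 := probReal_compl_eq_one_sub MeasurableSet.of_discrete
    linarith
  -- μ(B1 ∩ L1) = ℓ¹ − g1
  have eB1L1 : μ.real (B1 ∩ L1) = l1 - g1 := by
    have h := measureReal_inter_add_sdiff (μ := μ) (s := L1) (t := B1) MeasurableSet.of_discrete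
    have e1 : L1 ∩ B1 = B1 ∩ L1 := Set.inter_comm _ _
    have e2 : L1 \ B1 = B1ᶜ ∩ L1 := by ext ω; simp only [Set.mem_sdiff, Set.mem_inter_iff, Set.mem_compl_iff]; tauto
    rw [e1, e2] at h; linarith
  -- B0ᶜ = B1ᶜ ⊔ (B1 ∖ B0): inside and outside the big ball
  have eH0 : μ.real (B0ᶜ ∩ L0) = g1 + gS + vL := by
    have h := measureReal_inter_add_sdiff (μ := μ) (s := B0ᶜ ∩ L0) (t := B1) MeasurableSet.of_discrete
    have e1 : B0ᶜ ∩ L0 ∩ B1 = (B1 \ B0) ∩ L0 := by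
      ext ω; simp only [Set.mem_inter_iff, Set.mem_compl_iff, Set.mem_sdiff]; tauto
    have e2 : (B0ᶜ ∩ L0) \ B1 = B1ᶜ ∩ L0 := by
      ext ω; simp only [Set.mem_sdiff, Set.mem_inter_iff, Set.mem_compl_iff]
      constructor
      · rintro ⟨⟨_, h0⟩, h1⟩; exact ⟨h1, h0⟩
      · rintro ⟨h1, h0⟩; exact ⟨⟨fun hb => h1 (hB hb), h0⟩, h1⟩
    rw [e1, e2, eG0] at h; linarith
  have eHc : μ.real (B0ᶜ \ L0) = gc + vc := by
    have h := measureReal_inter_add_sdiff (μ := μ) (s := B0ᶜ \ L0) (t := B1) MeasurableSet.of_discrete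
    have e1 : (B0ᶜ \ L0) ∩ B1 = (B1 \ B0) \ L0 := by
      ext ω; simp only [Set.mem_inter_iff, Set.mem_compl_iff, Set.mem_sdiff]; tauto
    have e2 : (B0ᶜ \ L0) \ B1 = B1ᶜ \ L0 := by
      ext ω; simp only [Set.mem_sdiff, Set.mem_compl_iff]
      constructor
      · rintro ⟨⟨_, h0⟩, h1⟩; exact ⟨h1, h0⟩
      · rintro ⟨h1, h0⟩; exact ⟨⟨fun hb => h1 (hB hb), h0⟩, h1⟩
    rw [e1, e2] at h; linarith
  have eB0 : μ.real B0 = 1 - (g1 + gS + vL + gc + vc) := by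
    have h1 : μ.real B0ᶜ = 1 - μ.real B0 := probReal_compl_eq_one_sub MeasurableSet.of_discrete
    have h2 := measureReal_inter_add_sdiff (μ := μ) (s := B0ᶜ) (t := L0) MeasurableSet.of_discrete
    rw [eH0, eHc] at h2; linarith
  -- μ(B0 ∩ L0) = ℓ⁰ − μ(B0ᶜ ∩ L0)
  have eB0L0 : μ.real (B0 ∩ L0) = l1 + σ - (g1 + gS + vL) := by
    have h := measureReal_inter_add_sdiff (μ := μ) (s := L0) (t := B0) MeasurableSet.of_discrete
    have e1 : L0 ∩ B0 = B0 ∩ L0 := Set.inter_comm _ _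
    have e2 : L0 \ B0 = B0ᶜ ∩ L0 := by ext ω; simp only [Set.mem_sdiff, Set.mem_inter_iff, Set.mem_compl_iff]; tauto
    rw [e1, e2, eH0, eL0] at h; linarith
  rw [eL0, eB0, eB1, eB1L1, eB0L0, eH0]
  ring

/-- `κ ≥ 0`: for an increasing `B1` and the threshold balls `L¹ = {N_F < t} ⊆ L⁰ = {N_F < t+1}` with layer `S = {N_F = t}`:
`ℓ¹·μ(B1ᶜ ∩ S) ≤ σ·μ(B1ᶜ ∩ L¹)` — the decreasing event `B1ᶜ` prefers the ball below the layer (complement form of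
`real_inter_ball_mul_layer_le'`). [this work] -/
theorem kappa_nonneg (p : ι → unitInterval) (F : Finset ι) (t : ℕ) {B1 : Set (Set ι)} (hB1 : IsUpperSet B1) :
    (prodBernoulli p).real {ω : Set ι | (F.filter (· ∈ ω)).card < t} *
        (prodBernoulli p).real (B1ᶜ ∩ ({ω : Set ι | (F.filter (· ∈ ω)).card < t + 1} \ {ω : Set ι | (F.filter (· ∈ ω)).card < t})) ≤
      ((prodBernoulli p).real {ω : Set ι | (F.filter (· ∈ ω)).card < t + 1} -
          (prodBernoulli p).real {ω : Set ι | (F.filter (· ∈ ω)).card < t}) *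
        (prodBernoulli p).real (B1ᶜ ∩ {ω : Set ι | (F.filter (· ∈ ω)).card < t}) := by
  set μ := prodBernoulli p with hμ
  set L1 : Set (Set ι) := {ω : Set ι | (F.filter (· ∈ ω)).card < t} with hL1
  set L0 : Set (Set ι) := {ω : Set ι | (F.filter (· ∈ ω)).card < t + 1} with hL0
  set S : Set (Set ι) := {ω : Set ι | (F.filter (· ∈ ω)).card = t} with hS
  have hSeq : L0 \ L1 = S := by
    ext ω; simp only [hL0, hL1, hS, Set.mem_sdiff, Set.mem_setOf_eq, not_lt]; omega
  have hL10 : L1 ⊆ L0 := fun ω hω => by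
    simp only [hL1, hL0, Set.mem_setOf_eq] at hω ⊢; omega
  have eσ : μ.real L0 - μ.real L1 = μ.real S := by
    have h := measureReal_inter_add_sdiff (μ := μ) (s := L0) (t := L1) MeasurableSet.of_discrete
    rw [Set.inter_eq_right.2 hL10, hSeq] at h; linarith
  -- layer ≥ ball for the increasing event: μ(B1 ∩ L1)·σ ≤ μ(B1 ∩ S)·ℓ¹
  have hU : μ.real (B1 ∩ L1) * μ.real S ≤ μ.real (B1 ∩ S) * μ.real L1 := real_inter_ball_mul_layer_le' p F hB1 t
  have c1 : μ.real (B1ᶜ ∩ L1) = μ.real L1 - μ.real (B1 ∩ L1) := by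
    have h := measureReal_inter_add_sdiff (μ := μ) (s := L1) (t := B1) MeasurableSet.of_discrete
    have e1 : L1 ∩ B1 = B1 ∩ L1 := Set.inter_comm _ _
    have e2 : L1 \ B1 = B1ᶜ ∩ L1 := by ext ω; simp only [Set.mem_sdiff, Set.mem_inter_iff, Set.mem_compl_iff]; tauto
    rw [e1, e2] at h; linarith
  have c2 : μ.real (B1ᶜ ∩ S) = μ.real S - μ.real (B1 ∩ S) := by
    have h := measureReal_inter_add_sdiff (μ := μ) (s := S) (t := B1) MeasurableSet.of_discrete
    have e1 : S ∩ B1 = B1 ∩ S := Set.inter_comm _ _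
    have e2 : S \ B1 = B1ᶜ ∩ S := by ext ω; simp only [Set.mem_sdiff, Set.mem_inter_iff, Set.mem_compl_iff]; tauto
    rw [e1, e2] at h; linarith
  rw [hSeq, eσ, c1, c2]
  nlinarith [hU]

/-- **At every pivot one of the two inequalities holds**: if `X̃ = ℓ⁰μ(B1∩L¹) − ℓ¹μ(B0∩L⁰) ≤ 0` then `Ψ ≥ 0` (for the threshold balls,
`B0 ⊆ B1`, `B1` increasing).  In particular a vertex can fail to be a good pivot only by failing `X̃ ≥ 0`, or by having a POSITIVE
`X̃`-margin that is too large (`psi_nonneg_of_X_le_window`). [this work] -/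
theorem psi_nonneg_of_X_nonpos (p : ι → unitInterval) (F : Finset ι) (t : ℕ) {B0 B1 : Set (Set ι)} (hB : B0 ⊆ B1)
    (hB1 : IsUpperSet B1)
    (hX : (prodBernoulli p).real {ω : Set ι | (F.filter (· ∈ ω)).card < t + 1} *
          (prodBernoulli p).real (B1 ∩ {ω : Set ι | (F.filter (· ∈ ω)).card < t}) ≤
        (prodBernoulli p).real {ω : Set ι | (F.filter (· ∈ ω)).card < t} *
          (prodBernoulli p).real (B0 ∩ {ω : Set ι | (F.filter (· ∈ ω)).card < t + 1})) :
    (prodBernoulli p).real {ω : Set ι | (F.filter (· ∈ ω)).card < t} * (1 - (prodBernoulli p).real B1) *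
        ((prodBernoulli p).real {ω : Set ι | (F.filter (· ∈ ω)).card < t + 1} * (prodBernoulli p).real B0
          - (prodBernoulli p).real (B0 ∩ {ω : Set ι | (F.filter (· ∈ ω)).card < t + 1})) ≤
      (prodBernoulli p).real {ω : Set ι | (F.filter (· ∈ ω)).card < t + 1} * (1 - (prodBernoulli p).real B0) *
        ((prodBernoulli p).real {ω : Set ι | (F.filter (· ∈ ω)).card < t} * (prodBernoulli p).real B1
          - (prodBernoulli p).real (B1 ∩ {ω : Set ι | (F.filter (· ∈ ω)).card < t})) := by
  set μ := prodBernoulli p with hμ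
  set L1 : Set (Set ι) := {ω : Set ι | (F.filter (· ∈ ω)).card < t} with hL1
  set L0 : Set (Set ι) := {ω : Set ι | (F.filter (· ∈ ω)).card < t + 1} with hL0
  have hL10 : L1 ⊆ L0 := fun ω hω => by
    simp only [hL1, hL0, Set.mem_setOf_eq] at hω ⊢; omega
  have hid := psi_eq_window p hB hL10
  have hκ := kappa_nonneg p F t hB1
  have n1 : 0 ≤ μ.real (B0ᶜ ∩ L0) := measureReal_nonneg
  have n2 : 0 ≤ μ.real L0 := measureReal_nonneg
  have n3 : 0 ≤ μ.real (B1ᶜ ∩ L1) := measureReal_nonneg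
  have n4 : 0 ≤ μ.real ((B1 \ B0) \ L0) := measureReal_nonneg
  have n5 : 0 ≤ μ.real (B1ᶜ \ L0) := measureReal_nonneg
  have k1 : 0 ≤ μ.real (B0ᶜ ∩ L0) * ((μ.real L0 - μ.real L1) * μ.real (B1ᶜ ∩ L1) - μ.real L1 * μ.real (B1ᶜ ∩ (L0 \ L1))) :=
    mul_nonneg n1 (by linarith)
  have k2 : 0 ≤ μ.real L0 * μ.real (B1ᶜ ∩ L1) * μ.real ((B1 \ B0) \ L0) := mul_nonneg (mul_nonneg n2 n3) n4
  have k3 : 0 ≤ - (μ.real (B1ᶜ \ L0) * (μ.real L0 * μ.real (B1 ∩ L1) - μ.real L1 * μ.real (B0 ∩ L0))) := by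
    have : μ.real (B1ᶜ \ L0) * (μ.real L0 * μ.real (B1 ∩ L1) - μ.real L1 * μ.real (B0 ∩ L0)) ≤ 0 :=
      mul_nonpos_of_nonneg_of_nonpos n5 (by linarith)
    linarith
  linarith [hid, k1, k2, k3]

/-- **Quantitative window.**  For the threshold balls and `B0 ⊆ B1` (pure algebra, no monotonicity needed): if the `X̃`-margin is at most the window
`μ(B1ᶜ∖L⁰)·X̃ ≤ μ(B0ᶜ∩L⁰)·κ + ℓ⁰·μ(B1ᶜ∩L¹)·μ((B1∖B0)∖L⁰)` then `Ψ ≥ 0`.  (With `X̃ ≥ 0` this is a good pivot; the co-ball lemma is the case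
`μ(B1ᶜ∖L⁰) = 0`, and `psi_nonneg_of_X_nonpos` the case `X̃ ≤ 0`.) [this work] -/
theorem psi_nonneg_of_X_le_window (p : ι → unitInterval) (F : Finset ι) (t : ℕ) {B0 B1 : Set (Set ι)} (hB : B0 ⊆ B1)
    (hwin : (prodBernoulli p).real (B1ᶜ \ {ω : Set ι | (F.filter (· ∈ ω)).card < t + 1}) *
          ((prodBernoulli p).real {ω : Set ι | (F.filter (· ∈ ω)).card < t + 1} *
              (prodBernoulli p).real (B1 ∩ {ω : Set ι | (F.filter (· ∈ ω)).card < t})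
            - (prodBernoulli p).real {ω : Set ι | (F.filter (· ∈ ω)).card < t} *
              (prodBernoulli p).real (B0 ∩ {ω : Set ι | (F.filter (· ∈ ω)).card < t + 1})) ≤
        (prodBernoulli p).real (B0ᶜ ∩ {ω : Set ι | (F.filter (· ∈ ω)).card < t + 1}) *
            (((prodBernoulli p).real {ω : Set ι | (F.filter (· ∈ ω)).card < t + 1} -
                (prodBernoulli p).real {ω : Set ι | (F.filter (· ∈ ω)).card < t}) *
              (prodBernoulli p).real (B1ᶜ ∩ {ω : Set ι | (F.filter (· ∈ ω)).card < t})
              - (prodBernoulli p).real {ω : Set ι | (F.filter (· ∈ ω)).card < t} *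
                (prodBernoulli p).real (B1ᶜ ∩ ({ω : Set ι | (F.filter (· ∈ ω)).card < t + 1} \
                  {ω : Set ι | (F.filter (· ∈ ω)).card < t})))
          + (prodBernoulli p).real {ω : Set ι | (F.filter (· ∈ ω)).card < t + 1} *
              (prodBernoulli p).real (B1ᶜ ∩ {ω : Set ι | (F.filter (· ∈ ω)).card < t}) *
              (prodBernoulli p).real ((B1 \ B0) \ {ω : Set ι | (F.filter (· ∈ ω)).card < t + 1})) :
    (prodBernoulli p).real {ω : Set ι | (F.filter (· ∈ ω)).card < t} * (1 - (prodBernoulli p).real B1) *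
        ((prodBernoulli p).real {ω : Set ι | (F.filter (· ∈ ω)).card < t + 1} * (prodBernoulli p).real B0
          - (prodBernoulli p).real (B0 ∩ {ω : Set ι | (F.filter (· ∈ ω)).card < t + 1})) ≤
      (prodBernoulli p).real {ω : Set ι | (F.filter (· ∈ ω)).card < t + 1} * (1 - (prodBernoulli p).real B0) *
        ((prodBernoulli p).real {ω : Set ι | (F.filter (· ∈ ω)).card < t} * (prodBernoulli p).real B1
          - (prodBernoulli p).real (B1 ∩ {ω : Set ι | (F.filter (· ∈ ω)).card < t})) := by
  set μ := prodBernoulli p with hμ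
  set L1 : Set (Set ι) := {ω : Set ι | (F.filter (· ∈ ω)).card < t} with hL1
  set L0 : Set (Set ι) := {ω : Set ι | (F.filter (· ∈ ω)).card < t + 1} with hL0
  have hL10 : L1 ⊆ L0 := fun ω hω => by
    simp only [hL1, hL0, Set.mem_setOf_eq] at hω ⊢; omega
  have hid := psi_eq_window p hB hL10
  linarith [hid, hwin]

/-- **Co-ball lemma, re-derived from the identity**: if `B1 ⊇ (L⁰)ᶜ` (the increasing inner section contains the complement of the big ball)
then `Ψ ≥ 0` against every `B0 ⊆ B1` (cf. `psi_of_coball` in `…SahiOneStepCodimThree`, which needs neither nesting nor this file). [this work] -/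
theorem psi_nonneg_of_compl_subset_ball (p : ι → unitInterval) (F : Finset ι) (t : ℕ) {B0 B1 : Set (Set ι)} (hB : B0 ⊆ B1)
    (hB1 : IsUpperSet B1) (hco : B1ᶜ ⊆ {ω : Set ι | (F.filter (· ∈ ω)).card < t + 1}) :
    (prodBernoulli p).real {ω : Set ι | (F.filter (· ∈ ω)).card < t} * (1 - (prodBernoulli p).real B1) *
        ((prodBernoulli p).real {ω : Set ι | (F.filter (· ∈ ω)).card < t + 1} * (prodBernoulli p).real B0
          - (prodBernoulli p).real (B0 ∩ {ω : Set ι | (F.filter (· ∈ ω)).card < t + 1})) ≤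
      (prodBernoulli p).real {ω : Set ι | (F.filter (· ∈ ω)).card < t + 1} * (1 - (prodBernoulli p).real B0) *
        ((prodBernoulli p).real {ω : Set ι | (F.filter (· ∈ ω)).card < t} * (prodBernoulli p).real B1
          - (prodBernoulli p).real (B1 ∩ {ω : Set ι | (F.filter (· ∈ ω)).card < t})) := by
  set μ := prodBernoulli p with hμ
  set L1 : Set (Set ι) := {ω : Set ι | (F.filter (· ∈ ω)).card < t} with hL1
  set L0 : Set (Set ι) := {ω : Set ι | (F.filter (· ∈ ω)).card < t + 1} with hL0
  have hL10 : L1 ⊆ L0 := fun ω hω => by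
    simp only [hL1, hL0, Set.mem_setOf_eq] at hω ⊢; omega
  have hzero : μ.real (B1ᶜ \ L0) = 0 := by
    have : B1ᶜ \ L0 = ∅ := Set.sdiff_eq_empty.2 hco
    rw [this, measureReal_empty]
  refine psi_nonneg_of_X_le_window p F t hB ?_
  have hκ := kappa_nonneg p F t hB1
  have n1 : 0 ≤ μ.real (B0ᶜ ∩ L0) := measureReal_nonneg
  have n2 : 0 ≤ μ.real L0 := measureReal_nonneg
  have n3 : 0 ≤ μ.real (B1ᶜ ∩ L1) := measureReal_nonneg
  have n4 : 0 ≤ μ.real ((B1 \ B0) \ L0) := measureReal_nonneg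
  have k1 : 0 ≤ μ.real (B0ᶜ ∩ L0) * ((μ.real L0 - μ.real L1) * μ.real (B1ᶜ ∩ L1) - μ.real L1 * μ.real (B1ᶜ ∩ (L0 \ L1))) :=
    mul_nonneg n1 (by linarith)
  have k2 : 0 ≤ μ.real L0 * μ.real (B1ᶜ ∩ L1) * μ.real ((B1 \ B0) \ L0) := mul_nonneg (mul_nonneg n2 n3) n4
  rw [hzero, zero_mul]
  linarith

end SahiOneStep

end Summit.CriticalPhenomena.PercolationContinuityZ3.Theorems
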